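import Summits.CriticalPhenomena.CardyFormulaZ2.Theorems.CardyFlipRussoVoronoiHubFromSmirnovMoebiusOsculation
import Mathlib

/-!
# Helper `moebius_osculation_equidistant` — line `moebius-exact-delaunay-dilation-ward`,
# stub S3 `stub_conformalTransport` (crux `VoronoiHubFromSmirnov`, stmt-CriticalPhenomena-6433)

Benjamini–Schramm 1998, Lemma 4.1 (2)–(3): for `p, q` on a small circle of radius `r` about `x`,
a conformal map `h` admits a centre `y` **exactly** equidistant from `h p` and `h q` (the witness
centre the empty-disc rule needs), the image circle staying within `O(r³)` of the circle
`(y, ρ' = dist (h p) y)` with definite dilation across it; hypotheses as in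
`moebius_osculation_circle`.  Proof: with `a = h₁ x`, `β = h₂ x/(2a)`, `k = 1/(1 - ‖β‖² r²)`,
the osculating Möbius map `M z = h x + a u/(1 - βu)`, `u = z - x`, maps `‖u‖ = r` **onto** the
circle of centre `y₀ = h x + a conj β r² k`, radius `ρ₀ = ‖a‖ r k`, with the dilation
inequalities of `mo_dilation_real`, and `‖h - M‖ = O(r³)` (`me_pt`).  **Step 1.** `E = h - M` is
`O(r²)`-Lipschitz on `closedBall x r` and `‖h p - h q‖ ≥ (‖a‖/2)‖p - q‖` (`me_step1`, from
`crd_secant_remainder` and the Lipschitz bound `me_cubic_lip` for `β²u³/(1 - βu)`).  **Step 2.**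
Re-centre at the projection `y` of `y₀` to the perpendicular bisector of `[h p, h q]`
(`me_equidist`); by polarisation and Step 1, `‖y - y₀‖ = O(r³)`, the unknown size `‖a‖`
cancelling against the bi-Lipschitz bound (`me_recenter`).  **Step 3.** All distances move by
`O(r³)`, so the inequalities transfer (`me_local`).  All [folklore]; context: I. Benjamini,
O. Schramm, *Conformal invariance of Voronoi percolation*, CMP 197 (1998) 75–107, Lemma 4.1.
-/

noncomputable section

namespace Summit.CriticalPhenomena.CardyFormulaZ2.Cruxes.VoronoiHubFromSmirnov.MoebiusExactDelaunayDilationWard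

open Set Metric
open scoped ComplexConjugate

/-! ### Step 1: the error `h - M` is `O(r²)`-Lipschitz along the circle -/

/-- If `‖β‖ r ≤ 1/8` and `‖u‖ ≤ 2r` then `‖βu‖ ≤ 1/4` and `1 - βu ≠ 0`. [folklore] -/
theorem me_quarter {β u : ℂ} {r : ℝ} (hβr : ‖β‖ * r ≤ 1 / 8) (hN : ‖u‖ ≤ 2 * r) :
    ‖β * u‖ ≤ 1 / 4 ∧ 1 - β * u ≠ 0 := by
  have h : ‖β * u‖ ≤ 1 / 4 := by
    rw [norm_mul]; nlinarith [norm_nonneg β, norm_nonneg u, mul_le_mul_of_nonneg_left hN (norm_nonneg β)]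
  exact ⟨h, norm_pos_iff.1 (by linarith [(mo_norm_one_sub_bounds h).1])⟩

/-- The cubic Möbius correction `β² u³/(1 - βu)` is `6 ‖β‖² r²`-Lipschitz on `‖u‖ ≤ r` when
`‖β‖ r ≤ 1/8`. [folklore] -/
theorem me_cubic_lip {β u w : ℂ} {r : ℝ} (hr : 0 < r) (hβr : ‖β‖ * r ≤ 1 / 8) (hu : ‖u‖ ≤ r)
    (hw : ‖w‖ ≤ r) :
    ‖β ^ 2 * u ^ 3 / (1 - β * u) - β ^ 2 * w ^ 3 / (1 - β * w)‖ ≤ 6 * ‖β‖ ^ 2 * r ^ 2 * ‖u - w‖ := by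
  obtain ⟨hβu, hvu⟩ := me_quarter hβr (by linarith : ‖u‖ ≤ 2 * r)
  obtain ⟨hβw, hvw⟩ := me_quarter hβr (by linarith : ‖w‖ ≤ 2 * r)
  have hD : 9 / 16 ≤ ‖1 - β * u‖ * ‖1 - β * w‖ := by
    nlinarith [(mo_norm_one_sub_bounds hβu).1, (mo_norm_one_sub_bounds hβw).1]
  rw [div_sub_div _ _ hvu hvw, show β ^ 2 * u ^ 3 * (1 - β * w) - (1 - β * u) * (β ^ 2 * w ^ 3) =
      β ^ 2 * (u - w) * ((u ^ 2 + u * w + w ^ 2) - β * u * w * (u + w)) by ring, norm_div, norm_mul,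
    norm_mul, norm_mul, norm_pow, div_le_iff₀ (by positivity)]
  have hmul : ∀ {p q : ℂ} {s t : ℝ}, ‖p‖ ≤ s → ‖q‖ ≤ t → 0 ≤ s → ‖p * q‖ ≤ s * t :=
    fun hp hq hs => (norm_mul _ _).trans_le (mul_le_mul hp hq (norm_nonneg _) hs)
  have hN : ‖(u ^ 2 + u * w + w ^ 2) - β * u * w * (u + w)‖ ≤ 13 / 4 * r ^ 2 := by
    have h1 : ‖u ^ 2‖ ≤ r * r := by rw [pow_two]; exact hmul hu hu hr.le
    have h3 : ‖w ^ 2‖ ≤ r * r := by rw [pow_two]; exact hmul hw hw hr.le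
    have h4 : ‖β * u * w * (u + w)‖ ≤ ‖β‖ * r * r * (r + r) :=
      hmul (hmul (hmul le_rfl hu (norm_nonneg _)) hw (by positivity)) (norm_add_le_of_le hu hw) (by positivity)
    refine (norm_sub_le_of_le (norm_add_le_of_le (norm_add_le_of_le h1 (hmul hu hw hr.le)) h3)
      h4).trans ?_
    nlinarith [mul_le_mul_of_nonneg_right hβr (mul_nonneg hr.le hr.le)]
  have h0 : 0 ≤ ‖β‖ ^ 2 * r ^ 2 * ‖u - w‖ := by positivity
  nlinarith [mul_le_mul_of_nonneg_left hN (by positivity : 0 ≤ ‖β‖ ^ 2 * ‖u - w‖),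
    mul_le_mul_of_nonneg_left hD h0]

/-- **Step 1 at two points** `p ≠ q` of `closedBall x r ⊆ B` (`a = h₁ x`, `b = h₂ x`, `aβ = b/2`):
`‖h q - h p‖ ≥ (‖a‖/2)‖p - q‖` and `‖E p - E q‖ ≤ 2 (L + L²/m) r² ‖p - q‖`, `E = h - M`. [folklore] -/
theorem me_step1 {h h₁ h₂ : ℂ → ℂ} {B : Set ℂ} {L m : ℝ} (hm : 0 < m) (hL : 0 ≤ L)
    (hd1 : ∀ z ∈ B, HasDerivAt h (h₁ z) z) (hd2 : ∀ z ∈ B, HasDerivAt h₁ (h₂ z) z)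
    (hLip : ∀ z ∈ B, ∀ w ∈ B, ‖h₂ z - h₂ w‖ ≤ L * ‖z - w‖) {x : ℂ} {r : ℝ} (hr : 0 < r)
    (hr1 : r ≤ 1) (hLr : L * r ≤ m / 4) (hsub : closedBall x r ⊆ B) {a b β : ℂ}
    (ha : h₁ x = a) (hb : h₂ x = b) (ham : m ≤ ‖a‖) (hbL : ‖b‖ ≤ L) (haβ : a * β = b / 2)
    (hK : ‖a‖ * ‖β‖ ^ 2 ≤ L ^ 2 / (4 * m)) (hβr : ‖β‖ * r ≤ 1 / 8) {p q : ℂ}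
    (hp : ‖p - x‖ ≤ r) (hq : ‖q - x‖ ≤ r) (hpq : p ≠ q) :
    ‖a‖ / 2 * ‖p - q‖ ≤ ‖h q - h p‖ ∧
      ‖(h p - (h x + a * ((p - x) / (1 - β * (p - x))))) -
          (h q - (h x + a * ((q - x) / (1 - β * (q - x)))))‖ ≤
        2 * (L + L ^ 2 / m) * r ^ 2 * ‖p - q‖ := by
  have hS : Convex ℝ (closedBall x r) := convex_closedBall x r
  have hxS : x ∈ closedBall x r := mem_closedBall_self hr.le
  have key := crd_secant_remainder hS (fun w hw => (hd1 w (hsub hw)).hasDerivWithinAt)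
    (fun w hw => (hd2 w (hsub hw)).hasDerivWithinAt) hxS (fun w hw => mem_closedBall_iff_norm.1 hw)
    (fun w hw => (hLip w (hsub hw) x (hsub hxS)).trans
      (mul_le_mul_of_nonneg_left (mem_closedBall_iff_norm.1 hw) hL)) hr.le hL
    (mem_closedBall_iff_norm.2 hp) (mem_closedBall_iff_norm.2 hq) hpq
  rw [ha, hb] at key
  have hpq' : p - q ≠ 0 := sub_ne_zero.2 hpq
  have hbm : ‖b * ((p + q) / 2 - x)‖ ≤ L * r :=
    (norm_mul _ _).trans_le (mul_le_mul hbL (crd_midpoint_norm_le hp hq) (norm_nonneg _) hL)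
  have hLr2 : L * r ^ 2 ≤ L * r := mul_le_mul_of_nonneg_left (pow_le_of_le_one hr.le hr1 two_ne_zero) hL
  constructor
  · have h3 := norm_add_le_of_le hbm key
    rw [add_sub_cancel, norm_sub_rev] at h3
    have h5 := norm_sub_norm_le a ((h p - h q) / (p - q))
    calc ‖a‖ / 2 * ‖p - q‖ ≤ ‖(h p - h q) / (p - q)‖ * ‖p - q‖ :=
          mul_le_mul_of_nonneg_right (by linarith) (norm_nonneg _)
      _ = ‖h q - h p‖ := by rw [← norm_mul, div_mul_cancel₀ _ hpq', norm_sub_rev]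
  · have hgd : h p - h q = (h p - h q) / (p - q) * (p - q) := (div_mul_cancel₀ _ hpq').symm
    have e : (h p - (h x + a * ((p - x) / (1 - β * (p - x))))) -
        (h q - (h x + a * ((q - x) / (1 - β * (q - x))))) =
        (p - q) * ((h p - h q) / (p - q) - a - b * ((p + q) / 2 - x)) -
          a * (β ^ 2 * (p - x) ^ 3 / (1 - β * (p - x)) - β ^ 2 * (q - x) ^ 3 / (1 - β * (q - x))) := by
      rw [← mo_moebius_taylor β (p - x) (me_quarter hβr (by linarith)).2,
        ← mo_moebius_taylor β (q - x) (me_quarter hβr (by linarith)).2]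
      linear_combination hgd - ((p - x) ^ 2 - (q - x) ^ 2) * haβ
    have hcub := me_cubic_lip hr hβr hp hq; rw [sub_sub_sub_cancel_right] at hcub
    rw [e]
    refine (norm_sub_le_of_le ((norm_mul _ _).trans_le (mul_le_mul_of_nonneg_left key
      (norm_nonneg _))) ((norm_mul _ _).trans_le (mul_le_mul_of_nonneg_left hcub
      (norm_nonneg _)))).trans ?_
    have h4 : 6 * (‖a‖ * ‖β‖ ^ 2) * (r ^ 2 * ‖p - q‖) ≤ 6 * (L ^ 2 / (4 * m)) * (r ^ 2 * ‖p - q‖) :=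
      mul_le_mul_of_nonneg_right (by linarith) (by positivity)
    have h5 : 0 ≤ (L + 1 / 2 * (L ^ 2 / m)) * (r ^ 2 * ‖p - q‖) := by positivity
    rw [show ‖a‖ * (6 * ‖β‖ ^ 2 * r ^ 2 * ‖p - q‖) = 6 * (‖a‖ * ‖β‖ ^ 2) * (r ^ 2 * ‖p - q‖) by ring,
      show 2 * (L + L ^ 2 / m) * r ^ 2 * ‖p - q‖ = ‖p - q‖ * (L * r ^ 2) +
        6 * (L ^ 2 / (4 * m)) * (r ^ 2 * ‖p - q‖) + (L + 1 / 2 * (L ^ 2 / m)) * (r ^ 2 * ‖p - q‖) by ring]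
    linarith

/-- **Exact equidistant re-centring**: the projection `y = y₀ + t (Q - P)` of `y₀` to the bisector
of `[P, Q]` is equidistant from `P, Q`, and `‖y - y₀‖ · 2‖Q - P‖ = |‖Q - y₀‖² - ‖P - y₀‖²|`. [folklore] -/
theorem me_equidist (P Q y₀ : ℂ) :
    ‖P - (y₀ + (((‖Q - y₀‖ ^ 2 - ‖P - y₀‖ ^ 2) / (2 * ‖Q - P‖ ^ 2) : ℝ) : ℂ) * (Q - P))‖ =
      ‖Q - (y₀ + (((‖Q - y₀‖ ^ 2 - ‖P - y₀‖ ^ 2) / (2 * ‖Q - P‖ ^ 2) : ℝ) : ℂ) * (Q - P))‖ ∧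
    ‖(y₀ + (((‖Q - y₀‖ ^ 2 - ‖P - y₀‖ ^ 2) / (2 * ‖Q - P‖ ^ 2) : ℝ) : ℂ) * (Q - P)) - y₀‖ *
        (2 * ‖Q - P‖) = |‖Q - y₀‖ ^ 2 - ‖P - y₀‖ ^ 2| := by
  generalize ht : (‖Q - y₀‖ ^ 2 - ‖P - y₀‖ ^ 2) / (2 * ‖Q - P‖ ^ 2) = t
  rcases eq_or_ne Q P with rfl | hQP
  · simp
  have hv : 0 < ‖Q - P‖ := norm_pos_iff.2 (sub_ne_zero.2 hQP)
  have ht' : t * (2 * ‖Q - P‖ ^ 2) = ‖Q - y₀‖ ^ 2 - ‖P - y₀‖ ^ 2 := by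
    rw [← ht]; exact div_mul_cancel₀ _ (by positivity)
  constructor
  · refine (pow_left_inj₀ (norm_nonneg _) (norm_nonneg _) two_ne_zero).1 ?_
    rw [show P - (y₀ + (t : ℂ) * (Q - P)) = (P - y₀) - (t : ℂ) * (Q - P) by ring,
      show Q - (y₀ + (t : ℂ) * (Q - P)) = (Q - y₀) - (t : ℂ) * (Q - P) by ring]
    simp only [Complex.sq_norm, Complex.normSq_apply, Complex.sub_re, Complex.sub_im,
      Complex.mul_re, Complex.mul_im, Complex.ofReal_re, Complex.ofReal_im, zero_mul, sub_zero,
      add_zero] at ht' ⊢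
    linear_combination ht'
  · rw [add_sub_cancel_left, norm_mul, Complex.norm_real, Real.norm_eq_abs, ← ht', abs_mul,
      abs_of_pos (by positivity : (0 : ℝ) < 2 * ‖Q - P‖ ^ 2)]
    ring

/-- **The shift is `O(r³)`**: if `P - y₀ = α + e₁`, `Q - y₀ = α' + e₂`, `‖α‖ = ‖α'‖ = ρ₀ ≤ 2 nA r`,
`‖eᵢ‖ ≤ 8Λr³`, `‖e₁ - e₂‖ ≤ 2Λ r² d`, `nA d/2 ≤ ‖Q - P‖`, then `‖y - y₀‖ ≤ (16Λ + 32Λ²/m) r³`. [folklore] -/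
theorem me_recenter {P Q y₀ α α' e₁ e₂ : ℂ} {m Λ r nA ρ₀ d : ℝ} (hm : 0 < m) (hΛ : 0 ≤ Λ)
    (hr : 0 < r) (hr1 : r ≤ 1) (hA : m ≤ nA) (hPe : P - y₀ = α + e₁) (hQe : Q - y₀ = α' + e₂)
    (hα : ‖α‖ = ρ₀) (hα' : ‖α'‖ = ρ₀) (hρ : ρ₀ ≤ 2 * nA * r) (hd : 0 ≤ d)
    (hV : P ≠ Q → nA / 2 * d ≤ ‖Q - P‖) (hE1 : ‖e₁‖ ≤ 8 * Λ * r ^ 3)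
    (hE2 : ‖e₂‖ ≤ 8 * Λ * r ^ 3) (hE12 : P ≠ Q → ‖e₁ - e₂‖ ≤ 2 * Λ * r ^ 2 * d) :
    ‖(y₀ + (((‖Q - y₀‖ ^ 2 - ‖P - y₀‖ ^ 2) / (2 * ‖Q - P‖ ^ 2) : ℝ) : ℂ) * (Q - P)) - y₀‖ ≤
      (16 * Λ + 32 * (Λ ^ 2 / m)) * r ^ 3 := by
  rcases eq_or_ne P Q with rfl | hPQ
  · simp only [sub_self, mul_zero, add_sub_cancel_left, norm_zero]
    positivity
  replace hV := hV hPQ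
  replace hE12 := hE12 hPQ
  have hv : 0 < ‖Q - P‖ := norm_pos_iff.2 (sub_ne_zero.2 hPQ.symm)
  refine le_of_mul_le_mul_right ?_ (by positivity : (0 : ℝ) < 2 * ‖Q - P‖)
  rw [(me_equidist P Q y₀).2, abs_sub_comm, hPe, hQe]
  -- polarisation: the squared-norm difference is linear in the errors
  have hpol : ‖α + e₁‖ ^ 2 - ‖α' + e₂‖ ^ 2 = ((e₁ - e₂) * conj (2 * α + e₁)).re +
      (e₂ * conj (2 * ((α + e₁) - (α' + e₂)) - (e₁ - e₂))).re := by
    have h2 : ‖α‖ ^ 2 = ‖α'‖ ^ 2 := by rw [hα, hα']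
    simp only [Complex.sq_norm, Complex.normSq_apply, Complex.add_re, Complex.add_im,
      Complex.sub_re, Complex.sub_im, Complex.mul_re, Complex.mul_im, Complex.conj_re,
      Complex.conj_im, Complex.re_ofNat, Complex.im_ofNat] at h2 ⊢
    linear_combination h2
  have hin : ∀ p q : ℂ, |(p * conj q).re| ≤ ‖p‖ * ‖q‖ := fun p q =>
    (Complex.abs_re_le_norm _).trans_eq (by rw [norm_mul, Complex.norm_conj])
  have hPQn : (α + e₁) - (α' + e₂) = -(Q - P) := by rw [← hPe, ← hQe]; ring
  have h3 : ‖2 * α + e₁‖ ≤ 2 * ρ₀ + ‖e₁‖ :=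
    norm_add_le_of_le (by rw [norm_mul, RCLike.norm_ofNat, hα]) le_rfl
  have h4 : ‖2 * ((α + e₁) - (α' + e₂)) - (e₁ - e₂)‖ ≤ 2 * ‖Q - P‖ + ‖e₁ - e₂‖ :=
    norm_sub_le_of_le (by rw [norm_mul, RCLike.norm_ofNat, hPQn, norm_neg]) le_rfl
  rw [hpol]
  refine ((abs_add_le _ _).trans (add_le_add ((hin _ _).trans (mul_le_mul_of_nonneg_left h3
    (norm_nonneg _))) ((hin _ _).trans (mul_le_mul_of_nonneg_left h4 (norm_nonneg _))))).trans ?_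
  -- the real arithmetic: the factor `nA` cancels
  have hρ0 : 0 ≤ ρ₀ := hα ▸ norm_nonneg α
  have hdV : nA * d ≤ 2 * ‖Q - P‖ := by linarith
  have hdm : d ≤ 2 * ‖Q - P‖ / m := by
    rw [le_div_iff₀ hm]; nlinarith [mul_le_mul_of_nonneg_right hA hd]
  have hr3 : r ^ 5 ≤ r ^ 3 := pow_le_pow_of_le_one hr.le hr1 (by norm_num)
  have h1 : ‖e₁ - e₂‖ * (2 * ρ₀) ≤ 16 * Λ * r ^ 3 * ‖Q - P‖ := by
    calc ‖e₁ - e₂‖ * (2 * ρ₀) ≤ (2 * Λ * r ^ 2 * d) * (4 * nA * r) :=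
          mul_le_mul hE12 (by linarith) (by linarith) (by positivity)
      _ = 8 * Λ * r ^ 3 * (nA * d) := by ring
      _ ≤ 8 * Λ * r ^ 3 * (2 * ‖Q - P‖) := mul_le_mul_of_nonneg_left hdV (by positivity)
      _ = _ := by ring
  have h24 : ∀ {E : ℝ}, E ≤ 8 * Λ * r ^ 3 → E * ‖e₁ - e₂‖ ≤ 32 * (Λ ^ 2 / m) * r ^ 3 * ‖Q - P‖ := by
    intro E hE
    calc E * ‖e₁ - e₂‖ ≤ (8 * Λ * r ^ 3) * (2 * Λ * r ^ 2 * d) :=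
          mul_le_mul hE hE12 (norm_nonneg _) (by positivity)
      _ = 16 * Λ ^ 2 * (r ^ 5 * d) := by ring
      _ ≤ 16 * Λ ^ 2 * (r ^ 3 * (2 * ‖Q - P‖ / m)) :=
          mul_le_mul_of_nonneg_left (mul_le_mul hr3 hdm hd (by positivity)) (by positivity)
      _ = _ := by ring
  have h3 : ‖e₂‖ * (2 * ‖Q - P‖) ≤ 8 * Λ * r ^ 3 * (2 * ‖Q - P‖) :=
    mul_le_mul_of_nonneg_right hE2 (by positivity)
  linarith [h1, h24 hE1, h3, h24 hE2]

/-- **Pointwise facts** on `closedBall x (2r)` (`u = z - x`): `‖h z - (h x + a u/(1 - βu))‖ = O(r³)`,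
and the signed distance of `a u/(1 - βu)` to the circle (centre `a conj β r² k`, radius `‖a‖ r k`)
is `≥ (m/5)(‖u‖ - r)` if `‖u‖ ≥ r` and `≤ (m/5)(‖u‖ - r)` if `‖u‖ ≤ r`. [folklore] -/
theorem me_pt {h h₁ h₂ : ℂ → ℂ} {B : Set ℂ} {L m : ℝ} (hm : 0 < m) (hL : 0 ≤ L)
    (hd1 : ∀ z ∈ B, HasDerivAt h (h₁ z) z) (hd2 : ∀ z ∈ B, HasDerivAt h₁ (h₂ z) z)
    (hLip : ∀ z ∈ B, ∀ w ∈ B, ‖h₂ z - h₂ w‖ ≤ L * ‖z - w‖) {x : ℂ} {r k : ℝ} (hr : 0 < r)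
    (hsub : closedBall x (2 * r) ⊆ B) {a b β : ℂ} (ha : h₁ x = a) (hb : h₂ x = b)
    (ham : m ≤ ‖a‖) (haβ : a * β = b / 2) (hK : ‖a‖ * ‖β‖ ^ 2 ≤ L ^ 2 / (4 * m))
    (hβr : ‖β‖ * r ≤ 1 / 8) (hk : k * (1 - ‖β‖ ^ 2 * r ^ 2) = 1) (hk0 : 0 ≤ k) {z : ℂ}
    (hz : z ∈ closedBall x (2 * r)) :
    ‖h z - (h x + a * ((z - x) / (1 - β * (z - x))))‖ ≤ (8 * L + 3 * (L ^ 2 / m)) * r ^ 3 ∧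
    (r ≤ ‖z - x‖ → m / 5 * (‖z - x‖ - r) ≤
      ‖a * ((z - x) / (1 - β * (z - x))) - a * (conj β * ((r ^ 2 * k : ℝ) : ℂ))‖ - ‖a‖ * (r * k)) ∧
    (‖z - x‖ ≤ r → ‖a * ((z - x) / (1 - β * (z - x))) - a * (conj β * ((r ^ 2 * k : ℝ) : ℂ))‖ -
      ‖a‖ * (r * k) ≤ m / 5 * (‖z - x‖ - r)) := by
  have hx : x ∈ B := hsub (mem_closedBall_self (by positivity))
  obtain ⟨u, hu⟩ : ∃ u, z - x = u := ⟨_, rfl⟩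
  have hN : ‖u‖ ≤ 2 * r := by rw [← hu]; exact mem_closedBall_iff_norm.1 hz
  obtain ⟨hβu, hv⟩ := me_quarter hβr hN
  obtain ⟨hQ1, hQ2⟩ := mo_norm_one_sub_bounds hβu
  rw [hu]
  refine ⟨?_, ?_⟩
  · -- third-order contact: Taylor remainder of `h` plus the cubic Möbius correction
    have hR₃ : ‖h z - h x - a * u - b / 2 * u ^ 2‖ ≤ 8 * L * r ^ 3 := by
      have key := mo_taylor_remainder (r := 2 * r) (convex_closedBall x (2 * r))
        (fun w hw => (hd1 w (hsub hw)).hasDerivWithinAt)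
        (fun w hw => (hd2 w (hsub hw)).hasDerivWithinAt) (mem_closedBall_self (by positivity))
        (fun w hw => mem_closedBall_iff_norm.1 hw)
        (fun w hw => (hLip w (hsub hw) x hx).trans
          (mul_le_mul_of_nonneg_left (mem_closedBall_iff_norm.1 hw) hL)) (by positivity) hL hz
      rw [ha, hb, hu] at key
      calc _ ≤ L * (2 * r) ^ 2 * ‖u‖ := key
        _ ≤ L * (2 * r) ^ 2 * (2 * r) := mul_le_mul_of_nonneg_left hN (by positivity)
        _ = 8 * L * r ^ 3 := by ring
    have hMo : ‖a * (β ^ 2 * u ^ 3 / (1 - β * u))‖ ≤ 3 * (L ^ 2 / m) * r ^ 3 := by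
      rw [norm_mul, norm_div, norm_mul, norm_pow, norm_pow]
      have h2 : ‖u‖ ^ 3 / ‖1 - β * u‖ ≤ (2 * r) ^ 3 / (3 / 4) :=
        div_le_div₀ (by positivity) (pow_le_pow_left₀ (norm_nonneg _) hN 3) (by norm_num) hQ1
      calc ‖a‖ * (‖β‖ ^ 2 * ‖u‖ ^ 3 / ‖1 - β * u‖)
          = (‖a‖ * ‖β‖ ^ 2) * (‖u‖ ^ 3 / ‖1 - β * u‖) := by ring
        _ ≤ L ^ 2 / (4 * m) * ((2 * r) ^ 3 / (3 / 4)) :=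
            mul_le_mul hK h2 (by positivity) (by positivity)
        _ = 8 / 3 * (L ^ 2 / m * r ^ 3) := by ring
        _ ≤ 3 * (L ^ 2 / m) * r ^ 3 := by
            nlinarith [mul_nonneg (div_nonneg (sq_nonneg L) hm.le) (pow_nonneg hr.le 3)]
    rw [show h z - (h x + a * (u / (1 - β * u))) =
        (h z - h x - a * u - b / 2 * u ^ 2) - a * (β ^ 2 * u ^ 3 / (1 - β * u)) by
      rw [← mo_moebius_taylor β u hv]; linear_combination (-(u ^ 2)) * haβ]
    refine (norm_sub_le _ _).trans ?_
    linarith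
  -- the Möbius map and its image circle
  have hP : ‖u - conj β * ((r ^ 2 : ℝ) : ℂ)‖ ≤ 17 * r / 8 := by
    refine (norm_sub_le _ _).trans ?_
    rw [norm_mul, Complex.norm_conj, Complex.norm_of_nonneg (sq_nonneg r)]
    nlinarith [mul_le_mul_of_nonneg_right hβr hr.le]
  have hdil := mo_dilation_real hr (norm_nonneg u) hQ1 hQ2 (norm_nonneg _) hP
    (mo_norm_identity β u (r ^ 2)) hk
  rw [← mul_sub, mo_moebius_sub_center β u hk hv, norm_mul, norm_div, norm_mul,
    Complex.norm_of_nonneg hk0]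
  refine ⟨fun hrN => ?_, fun hNr => ?_⟩
  · linarith [mul_le_mul_of_nonneg_right ham (by linarith : (0 : ℝ) ≤ 1 / 5 * (‖u‖ - r)),
      mul_le_mul_of_nonneg_left (hdil.1 hrN) (norm_nonneg a)]
  · linarith [mul_le_mul_of_nonneg_left (hdil.2 hNr) (norm_nonneg a),
      mul_le_mul_of_nonpos_right ham (by linarith : 1 / 5 * (‖u‖ - r) ≤ 0)]

/-- **The local statement** for `closedBall x (2r) ⊆ B`, `0 < r ≤ min (m/(4(L+1))) 1`, `p, q` on
the circle `dist · x = r` (`κ = m/5`, `C = 64 (Λ + Λ²/m)`, `Λ = L + L²/m`). [folklore] -/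
theorem me_local {h h₁ h₂ : ℂ → ℂ} {B : Set ℂ} {L m : ℝ} (hm : 0 < m) (hL : 0 ≤ L)
    (hd1 : ∀ z ∈ B, HasDerivAt h (h₁ z) z) (hd2 : ∀ z ∈ B, HasDerivAt h₁ (h₂ z) z)
    (hm1 : ∀ z ∈ B, m ≤ ‖h₁ z‖) (hL2 : ∀ z ∈ B, ‖h₂ z‖ ≤ L)
    (hLip : ∀ z ∈ B, ∀ w ∈ B, ‖h₂ z - h₂ w‖ ≤ L * ‖z - w‖) {x : ℂ} {r : ℝ} (hr : 0 < r)
    (hrm : r ≤ m / (4 * (L + 1))) (hr1 : r ≤ 1) (hsub : closedBall x (2 * r) ⊆ B) {p q : ℂ}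
    (hp : dist p x = r) (hq : dist q x = r) :
    ∃ (y : ℂ) (ρ' : ℝ), dist (h p) y = ρ' ∧ dist (h q) y = ρ' ∧
      dist y (h x) ≤ 64 * ((L + L ^ 2 / m) + (L + L ^ 2 / m) ^ 2 / m) * r ^ 2 ∧
      ∀ z ∈ closedBall x (2 * r),
        (r ≤ dist z x → m / 5 * (dist z x - r) -
          64 * ((L + L ^ 2 / m) + (L + L ^ 2 / m) ^ 2 / m) * r ^ 3 ≤ dist (h z) y - ρ') ∧
        (dist z x ≤ r → dist (h z) y - ρ' ≤ m / 5 * (dist z x - r) +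
          64 * ((L + L ^ 2 / m) + (L + L ^ 2 / m) ^ 2 / m) * r ^ 3) := by
  -- data at the centre: `a = h₁ x`, `b = h₂ x`, `β = b / (2a)`, `k`, `Λ`
  have hx : x ∈ B := hsub (mem_closedBall_self (by positivity))
  obtain ⟨a, ha⟩ : ∃ a, h₁ x = a := ⟨_, rfl⟩
  obtain ⟨b, hb⟩ : ∃ b, h₂ x = b := ⟨_, rfl⟩
  have ham : m ≤ ‖a‖ := ha ▸ hm1 x hx
  have ha0' : a ≠ 0 := norm_pos_iff.1 (hm.trans_le ham)
  have hbL : ‖b‖ ≤ L := hb ▸ hL2 x hx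
  obtain ⟨β, hβ_def⟩ : ∃ β : ℂ, β = b / (2 * a) := ⟨_, rfl⟩
  have haβ : a * β = b / 2 := by rw [hβ_def]; field_simp
  have haβn : ‖a‖ * ‖β‖ = ‖b‖ / 2 := by rw [← norm_mul, haβ, norm_div, RCLike.norm_ofNat]
  have hLr : L * r ≤ m / 4 := by nlinarith [(le_div_iff₀ (by positivity)).1 hrm]
  have hmβ : m * ‖β‖ ≤ ‖b‖ / 2 := by rw [← haβn]; exact mul_le_mul_of_nonneg_right ham (norm_nonneg β)
  have hβr : ‖β‖ * r ≤ 1 / 8 := by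
    refine le_of_mul_le_mul_left ?_ hm
    nlinarith [mul_le_mul_of_nonneg_right hmβ hr.le, mul_le_mul_of_nonneg_right hbL hr.le]
  have hK : ‖a‖ * ‖β‖ ^ 2 ≤ L ^ 2 / (4 * m) := by
    rw [le_div_iff₀ (by positivity),
      show ‖a‖ * ‖β‖ ^ 2 * (4 * m) = 4 * (‖a‖ * ‖β‖) * (m * ‖β‖) by ring, haβn]
    nlinarith [mul_le_mul_of_nonneg_left hmβ (norm_nonneg b), mul_self_le_mul_self (norm_nonneg b) hbL]
  have ht : ‖β‖ ^ 2 * r ^ 2 ≤ 1 / 64 := by nlinarith [mul_nonneg (norm_nonneg β) hr.le]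
  have ht0 : 0 ≤ ‖β‖ ^ 2 * r ^ 2 := by positivity
  have hpos : 0 < 1 - ‖β‖ ^ 2 * r ^ 2 := by linarith
  obtain ⟨k, hk_def⟩ : ∃ k : ℝ, k = 1 / (1 - ‖β‖ ^ 2 * r ^ 2) := ⟨_, rfl⟩
  have hk : k * (1 - ‖β‖ ^ 2 * r ^ 2) = 1 := by rw [hk_def]; exact div_mul_cancel₀ _ hpos.ne'
  have hk2 : k ≤ 2 := by rw [hk_def, div_le_iff₀ hpos]; linarith
  have hk0 : 0 ≤ k := by rw [hk_def]; positivity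
  set Λ : ℝ := L + L ^ 2 / m with hΛ
  have hΛ0 : 0 ≤ Λ := by positivity
  have hC0 : (8 * L + 3 * (L ^ 2 / m)) * r ^ 3 ≤ 8 * Λ * r ^ 3 :=
    mul_le_mul_of_nonneg_right (by rw [hΛ]; linarith [(by positivity : (0 : ℝ) ≤ L ^ 2 / m)])
      (by positivity)
  -- the centre `y₀` of the Möbius image circle; pointwise facts; Step 1 at `p, q`
  obtain ⟨y₀, hy₀⟩ : ∃ y₀ : ℂ, y₀ = h x + a * (conj β * ((r ^ 2 * k : ℝ) : ℂ)) := ⟨_, rfl⟩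
  have hpt := fun z hz => me_pt hm hL hd1 hd2 hLip hr hsub ha hb ham haβ hK hβr hk hk0 (z := z) hz
  have hcirc : ∀ z : ℂ, ‖z - x‖ = r →
      ‖a * ((z - x) / (1 - β * (z - x))) - a * (conj β * ((r ^ 2 * k : ℝ) : ℂ))‖ = ‖a‖ * (r * k) := by
    intro z hz
    obtain ⟨-, h1, h2⟩ := hpt z (mem_closedBall_iff_norm.2 (by rw [hz]; linarith))
    have h1 := h1 hz.ge; have h2 := h2 hz.le
    rw [hz, sub_self, mul_zero] at h1 h2; linarith
  have hpn : ‖p - x‖ = r := by rw [← dist_eq_norm, hp]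
  have hqn : ‖q - x‖ = r := by rw [← dist_eq_norm, hq]
  have hpB : p ∈ closedBall x (2 * r) := mem_closedBall_iff_norm.2 (by rw [hpn]; linarith)
  have hqB : q ∈ closedBall x (2 * r) := mem_closedBall_iff_norm.2 (by rw [hqn]; linarith)
  have hdec : ∀ w c : ℂ, h w - c = (a * ((w - x) / (1 - β * (w - x))) - a * (conj β * ((r ^ 2 * k : ℝ) : ℂ)))
      + ((h w - (h x + a * ((w - x) / (1 - β * (w - x))))) - (c - y₀)) := by
    intro w c; rw [hy₀]; ring
  have hPe := hdec p y₀; have hQe := hdec q y₀; rw [sub_self, sub_zero] at hPe hQe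
  have hVE := fun hne : h p ≠ h q => me_step1 hm hL hd1 hd2 hLip hr hr1 hLr
    ((closedBall_subset_closedBall (by linarith)).trans hsub) ha hb ham hbL haβ hK hβr hpn.le
    hqn.le (fun e => hne (by rw [e]))
  -- Step 2: the re-centred `y` and the size of the shift
  have hρ : ‖a‖ * (r * k) ≤ 2 * ‖a‖ * r := by
    rw [show 2 * ‖a‖ * r = ‖a‖ * (r * 2) by ring]
    exact mul_le_mul_of_nonneg_left (mul_le_mul_of_nonneg_left hk2 hr.le) (norm_nonneg a)
  have hs := me_recenter (P := h p) (Q := h q) hm hΛ0 hr hr1 ham hPe hQe (hcirc p hpn) (hcirc q hqn)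
    hρ (norm_nonneg (p - q)) (fun hne => (hVE hne).1) ((hpt p hpB).1.trans hC0)
    ((hpt q hqB).1.trans hC0) (fun hne => by rw [hΛ]; exact (hVE hne).2)
  obtain ⟨y, hy⟩ : ∃ y : ℂ, y = y₀ + (((‖h q - y₀‖ ^ 2 - ‖h p - y₀‖ ^ 2) /
      (2 * ‖h q - h p‖ ^ 2) : ℝ) : ℂ) * (h q - h p) := ⟨_, rfl⟩
  have heq := (me_equidist (h p) (h q) y₀).1
  rw [← hy] at hs heq
  -- Step 3: transfer of the inequalities from `(y₀, ρ₀)` to `(y, ρ')`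
  have hy₀x : ‖y₀ - h x‖ ≤ Λ * r ^ 2 := by
    rw [hy₀, add_sub_cancel_left, norm_mul, norm_mul, Complex.norm_conj,
      Complex.norm_of_nonneg (by positivity), ← mul_assoc, haβn,
      show Λ * r ^ 2 = L / 2 * (r ^ 2 * 2) + L ^ 2 / m * r ^ 2 by rw [hΛ]; ring]
    have h1 : ‖b‖ / 2 * (r ^ 2 * k) ≤ L / 2 * (r ^ 2 * 2) := by gcongr
    linarith [(by positivity : 0 ≤ L ^ 2 / m * r ^ 2)]
  have hΛr : 0 ≤ (16 * Λ + 32 * (Λ ^ 2 / m)) := by positivity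
  have hdev : ∀ w ∈ closedBall x (2 * r), |‖h w - y‖ -
      ‖a * ((w - x) / (1 - β * (w - x))) - a * (conj β * ((r ^ 2 * k : ℝ) : ℂ))‖| ≤
      8 * Λ * r ^ 3 + (16 * Λ + 32 * (Λ ^ 2 / m)) * r ^ 3 := by
    intro w hw
    have h1 := abs_norm_sub_norm_le (h w - y)
      (a * ((w - x) / (1 - β * (w - x))) - a * (conj β * ((r ^ 2 * k : ℝ) : ℂ)))
    rw [hdec w y, add_sub_cancel_left, ← hdec w y] at h1
    exact h1.trans (norm_sub_le_of_le (((hpt w hw).1.trans hC0)) hs)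
  refine ⟨y, dist (h p) y, rfl, ?_, ?_, ?_⟩
  · rw [dist_eq_norm, dist_eq_norm, heq]
  · have h1 : dist y (h x) ≤ ‖y - y₀‖ + ‖y₀ - h x‖ := by
      rw [← dist_eq_norm, ← dist_eq_norm]; exact dist_triangle y y₀ (h x)
    have h2 : (16 * Λ + 32 * (Λ ^ 2 / m)) * r ^ 3 ≤ (16 * Λ + 32 * (Λ ^ 2 / m)) * r ^ 2 :=
      mul_le_mul_of_nonneg_left (pow_le_pow_of_le_one hr.le hr1 (by norm_num)) hΛr
    linarith [hs, hy₀x, (by positivity : 0 ≤ Λ * r ^ 2), (by positivity : 0 ≤ Λ ^ 2 / m * r ^ 2)]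
  intro z hz
  obtain ⟨-, hout, hin⟩ := hpt z hz
  have hz2 := abs_le.1 (hdev z hz)
  have hp2 := abs_le.1 (hdev p hpB)
  rw [hcirc p hpn] at hp2
  have hΛ3 : 0 ≤ Λ * r ^ 3 := by positivity
  rw [dist_eq_norm (h z), dist_eq_norm (h p), dist_eq_norm z x]
  exact ⟨fun hrN => by linarith [hout hrN, hz2.1, hp2.2], fun hNr => by linarith [hin hNr, hz2.2, hp2.1]⟩

/-- **BS98 Lemma 4.1 (2)–(3) (planar, metric form): exact equidistant re-centring.**  Under the
`C¹'¹` hypotheses of `moebius_osculation_circle` there are `C`, `κ > 0`, `r₀ > 0` such that for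
every disc `closedBall x (2r) ⊆ B`, `0 < r ≤ r₀`, and `p, q` on the circle `dist · x = r`, some
`y` with `dist y (h x) ≤ C r²` has `dist (h p) y = dist (h q) y = ρ'` **exactly** and
`dist (h z) y - ρ' ≥ κ (dist z x - r) - C r³` outside, `≤ κ (dist z x - r) + C r³` inside
(`κ = m/5`, `r₀ = min (m/(4(L+1))) 1`, `C = 64 (Λ + Λ²/m)`, `Λ = L + L²/m`). -/
theorem moebius_osculation_equidistant : ∀ (h h₁ h₂ : ℂ → ℂ) (B : Set ℂ) (L m : ℝ), Convex ℝ B → 0 < m → (∀ z ∈ B, HasDerivAt h (h₁ z) z) → (∀ z ∈ B, HasDerivAt h₁ (h₂ z) z) → (∀ z ∈ B, m ≤ ‖h₁ z‖) → (∀ z ∈ B, ‖h₂ z‖ ≤ L) → (∀ z ∈ B, ∀ w ∈ B, ‖h₂ z - h₂ w‖ ≤ L * ‖z - w‖) → ∃ C κ r₀ : ℝ, 0 < κ ∧ 0 < r₀ ∧ ∀ (x : ℂ) (r : ℝ), 0 < r → r ≤ r₀ → Metric.closedBall x (2 * r) ⊆ B → ∀ p q : ℂ, dist p x = r → dist q x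 = r → ∃ (y : ℂ) (ρ' : ℝ), dist (h p) y = ρ' ∧ dist (h q) y = ρ' ∧ dist y (h x) ≤ C * r ^ 2 ∧ ∀ z ∈ Metric.closedBall x (2 * r), (r ≤ dist z x → κ * (dist z x - r) - C * r ^ 3 ≤ dist (h z) y - ρ') ∧ (dist z x ≤ r → dist (h z) y - ρ' ≤ κ * (dist z x - r) + C * r ^ 3) := by
  intro h h₁ h₂ B L m _ hm hd1 hd2 hm1 hL2 hLip
  by_cases hL : 0 ≤ L
  swap
  · exact ⟨0, 1, 1, one_pos, one_pos, fun x r hr _ hsub =>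
      absurd ((norm_nonneg _).trans (hL2 x (hsub (mem_closedBall_self (by positivity))))) hL⟩
  exact ⟨64 * ((L + L ^ 2 / m) + (L + L ^ 2 / m) ^ 2 / m), m / 5, min (m / (4 * (L + 1))) 1,
    by positivity, lt_min (by positivity) one_pos,
    fun x r hr hr0 hsub p q hp hq => me_local hm hL hd1 hd2 hm1 hL2 hLip hr
      (hr0.trans (min_le_left _ _)) (hr0.trans (min_le_right _ _)) hsub hp hq⟩

end Summit.CriticalPhenomena.CardyFormulaZ2.Cruxes.VoronoiHubFromSmirnov.MoebiusExactDelaunayDilationWard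

end
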